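import Literature.Barriers.CriticalPhenomena.WeaklySAWPerturbativeA2
import Literature.Barriers.CriticalPhenomena.WeaklySAWPerturbativeCoefficientsContinuity
import Literature.Barriers.CriticalPhenomena.WeaklySAWQuadraticFlowContinuity
import Literature.Barriers.CriticalPhenomena.WeaklySAWQuadraticFlowDerivContinuity
import HarnessLib

/-!
# BBS 2015, Proposition 6.1.1 for the weakly self-avoiding walk: the global flow `V̄ = (ḡ, z̄, μ̄)` of
# the EXPLICIT quadratic flow `φ̄(m²)`, its bounds, uniqueness, and continuity in `(m², ḡ₀)`

Source: Bauerschmidt–Brydges–Slade, CMP 337 (2015) [BBS2015], §6.1, Proposition 6.1.1: "If `ḡ₀ > 0` is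
sufficiently small, then there exists a unique global flow `V̄ = (ḡ_j, z̄_j, μ̄_j)_{j∈ℕ₀}` of `φ̄`, i.e., a
solution to `V̄_{j+1} = φ̄_j(V̄_j)` defined for all `j ∈ ℕ₀`, with initial condition `ḡ₀` and final
condition `(z̄_∞, μ̄_∞) = (0,0)`. This flow satisfies, for any real `p ∈ [1,∞)`,
`χ_jḡ_j^p = O(ḡ₀/(1+ḡ₀j))^p`, `z̄_j = O(χ_jḡ_j)`, `μ̄_j = O(χ_jḡ_j)`, with constants independent of
`j_Ω` and `ḡ₀`, and dependent on `p` in the first bound. Furthermore, `V̄_j` is continuously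
differentiable in the initial condition `ḡ₀` and continuous in the mass parameter `m²`, for every
`j ∈ ℕ₀`." — "the following proposition is a special case of [BBS-rg-flow, Proposition 1.2]", applied
under Assumptions (A1)–(A2), which "in [BBS-rg-pt], it is verified … are satisfied".

This file closes that chain of citations for the explicit flow of this tree: the abstract
[BBS-rg-flow, Proposition 1.2] is the tree's `quadFlow_exists_unique` (existence, uniqueness, bounds;
`WeaklySAWQuadraticFlowCutoff.lean`) and `continuousOn_flow_param` (continuity in an external parameter;
`WeaklySAWQuadraticFlowContinuity.lean`); Assumptions (A1)–(A2) for `φ̄(m²) = wsawQuadFlow L m²` are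
`hypA1_and_hypA2_wsawQuadFlow` (`WeaklySAWPerturbativeA2.lean`, uniformly in `m² ∈ [0,δ]`); the
continuity of the coefficients in `m²` is `WeaklySAWPerturbativeCoefficientsContinuity.lean`.

## What this file proves (no definition, no named fact)

* `coeffContinuous_wsawQuadFlow` — the eleven coefficient sequences of `φ̄(m²)` are continuous in `m²`
  on any `S ⊆ [0,∞)` (`CoeffContinuous`, the hypothesis of `continuousOn_flow_param`);
* **`BBS2015_prop611`** — Proposition 6.1.1 for the weakly self-avoiding walk in `d = 4` (`L ≥ 2`,
  `Ω > 1`): there are `δ ∈ (0,1]`, `g₁ > 0`, `C'`, `C_p` such that for every `m² ∈ [0,δ]` and every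
  `ḡ₀ ∈ (0,g₁)` the sequence `V̄ = (wsawQuadFlow L m²).flow ḡ₀` is a global flow of `φ̄(m²)` with
  `ḡ₀` prescribed and `(z̄_∞, μ̄_∞) = (0,0)`, it is the UNIQUE such flow, `0 < ḡ_j ≤ C'ḡ₀`,
  `χ_jḡ_j^p ≤ C_p(ḡ₀/(1+ḡ₀j))^p` (real `p ≥ 1`), `|z̄_j|, |μ̄_j| ≤ C'χ_jḡ_j`, and `(m², ḡ₀) ↦ V̄_j` is
  continuous on `[0,δ] × (0,g₁)` for every `j`;
* `BBS2015_prop611_critical` — at `m² = 0` (`χ_j = 1`): `ḡ_j^p ≤ C_p(ḡ₀/(1+ḡ₀j))^p`,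
  `|z̄_j|, |μ̄_j| ≤ C'ḡ_j`;
* **`BBS2015_prop611_hasDerivAt`** — the differentiability clause: for `m² ∈ [0,δ]`, `ḡ₀ ∈ (0,g₁)`
  and every `j`, each component of `ḡ₀ ↦ V̄_j(m², ḡ₀)` is differentiable, with
  `|ḡ_j'| ≤ ḡ_j²/ḡ₀²`, `|z̄_j'|, |μ̄_j'| ≤ Kχ_jḡ_j²/ḡ₀²` ([BBS-rg-flow, Lemma 2.3, (2.33)], from
  `WeaklySAWQuadraticFlowDeriv.lean`), and the three derivatives are continuous in `ḡ₀`
  (`WeaklySAWQuadraticFlowDerivContinuity.lean`): `V̄_j` is continuously differentiable in `ḡ₀`.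

Deliberately NOT here: the second derivatives of [BBS-rg-flow, Lemma 2.3].
-/

noncomputable section

open Set Filter Topology
open Literature.Probability.LatticeModels
open scoped BigOperators

namespace Literature.Barriers.CriticalPhenomena

namespace CTWSAW

open LongRangePhi4 LongRangePhi4.FRD PT

/-- The `β`-sequence of `φ̄(m²)` is `β_j(m²)`. [cite: BauerschmidtBrydgesSlade2015LogCorr, §6.1 (display of φ̄_j)] -/
@[simp] theorem wsawQuadFlow_β (L s : ℝ) : (wsawQuadFlow L s).β = betaPT 4 L s := rfl

/-- A function continuous within `[0,∞)` at every point of `[0,∞)` is continuous on (the subtype of)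
any `S ⊆ [0,∞)`. [folklore] -/
theorem continuous_restrict_of_continuousWithinAt_Ici {f : ℝ → ℝ} {S : Set ℝ} (hS : S ⊆ Ici 0)
    (h : ∀ s₀ : ℝ, 0 ≤ s₀ → ContinuousWithinAt f (Ici 0) s₀) : Continuous fun m : S => f m :=
  continuousOn_iff_continuous_restrict.1 fun x hx => (h x (hS hx)).mono hS

/-- **"These coefficients, and hence also `φ̄`, depend continuously on the mass `m²`"**: the eleven
coefficient sequences of `φ̄(m²) = wsawQuadFlow L m²` are continuous in `m²` on any `S ⊆ [0,∞)`
(`L ≥ 1`) — the hypothesis `CoeffContinuous` of [BBS-rg-flow, Proposition 1.2 (continuity clause)].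
[cite: BauerschmidtBrydgesSlade2015LogCorr, §6.1 ("depend continuously on the mass m²") and Proposition 6.1.1 ("continuous in the mass parameter m²")] -/
theorem coeffContinuous_wsawQuadFlow {L : ℝ} (hL : 1 ≤ L) {S : Set ℝ} (hS : S ⊆ Ici 0) :
    CoeffContinuous (fun m : S => wsawQuadFlow L (m : ℝ)) := by
  have hd : 1 ≤ 4 := by norm_num
  have hL0 : 0 ≤ L := zero_le_one.trans hL
  exact
    { η := fun j => continuous_restrict_of_continuousWithinAt_Ici (f := fun s => etaPT 4 L s j) hS
        fun s₀ hs₀ => continuousWithinAt_etaPT_mass hd hL0 j hs₀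
      γ := fun _ => continuous_const
      lam := fun _ => continuous_const
      β := fun j => continuous_restrict_of_continuousWithinAt_Ici (f := fun s => betaPT 4 L s j) hS
        fun s₀ hs₀ => continuousWithinAt_betaPT_mass hd hL j hs₀
      θ := fun j => continuous_restrict_of_continuousWithinAt_Ici (f := fun s => thetaPT 4 L s j) hS
        fun s₀ hs₀ => continuousWithinAt_thetaPT_mass hd hL j hs₀
      ζ := fun _ => continuous_const
      υgg := fun j => continuous_restrict_of_continuousWithinAt_Ici (f := fun s => xiPT 4 L s j) hS
        fun s₀ hs₀ => continuousWithinAt_xiPT_mass hd hL j hs₀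
      υgz := fun j => continuous_restrict_of_continuousWithinAt_Ici (f := fun s => piPT 4 L s j) hS
        fun s₀ hs₀ => continuousWithinAt_piPT_mass hd hL j hs₀
      υgμ := fun j => continuous_restrict_of_continuousWithinAt_Ici (f := fun s => omegaPT 4 L s j) hS
        fun s₀ hs₀ => continuousWithinAt_omegaPT_mass hd hL j hs₀
      υzz := fun _ => continuous_const
      υzμ := fun _ => continuous_const }

/-- **BBS 2015, Proposition 6.1.1, for the weakly self-avoiding walk in `d = 4`** (explicit
decomposition, `L ≥ 2`, `Ω > 1`): there are `δ ∈ (0,1]`, `g₁ > 0` and constants `C'`, `C_p` such that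
for every mass `m² ∈ [0,δ]` and every `ḡ₀ ∈ (0,g₁)`, `V̄ = (wsawQuadFlow L m²).flow ḡ₀ = (ḡ, z̄, μ̄)`
is a global flow of `φ̄(m²)` with initial condition `ḡ₀` and final condition `(z̄_∞, μ̄_∞) = (0,0)`;
it is the unique such flow; `0 < ḡ_j ≤ C'ḡ₀`, `χ_jḡ_j^p ≤ C_p(ḡ₀/(1+ḡ₀j))^p` for real `p ≥ 1`,
`|z̄_j| ≤ C'χ_jḡ_j`, `|μ̄_j| ≤ C'χ_jḡ_j` (constants independent of `m²`, hence of `j_Ω`, and of `ḡ₀`);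
and `V̄_j` is (jointly) continuous in `(m², ḡ₀) ∈ [0,δ] × (0,g₁)` for every `j`.
[cite: BauerschmidtBrydgesSlade2015LogCorr, Proposition 6.1.1 ("a special case of [BBS-rg-flow, Proposition 1.2]", under Assumptions (A1)–(A2) of §6.1)] -/
theorem BBS2015_prop611 {L : ℝ} (hL : 2 ≤ L) {Ω : ℝ} (hΩ : 1 < Ω) :
    ∃ δ g₁ C' : ℝ, ∃ Cn : ℝ → ℝ, 0 < δ ∧ δ ≤ 1 ∧ 0 < g₁ ∧
      (∀ s : ℝ, 0 ≤ s → s ≤ δ → ∀ g₀ : ℝ, 0 < g₀ → g₀ < g₁ →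
        IsQuadFlowBC (wsawQuadFlow L s) g₀ ((wsawQuadFlow L s).flow g₀) ∧
        (∀ Vb : ℕ → V3, IsQuadFlowBC (wsawQuadFlow L s) g₀ Vb → Vb = (wsawQuadFlow L s).flow g₀) ∧
        (∀ j, 0 < (wsawQuadFlow L s).flow g₀ j 0 ∧ (wsawQuadFlow L s).flow g₀ j 0 ≤ C' * g₀) ∧
        (∀ n : ℝ, 1 ≤ n → ∀ j : ℕ,
          chi (betaPT 4 L s) Ω j * (wsawQuadFlow L s).flow g₀ j 0 ^ n ≤
            Cn n * (g₀ / (1 + g₀ * j)) ^ n) ∧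
        (∀ j, |(wsawQuadFlow L s).flow g₀ j 1| ≤
          C' * chi (betaPT 4 L s) Ω j * (wsawQuadFlow L s).flow g₀ j 0) ∧
        (∀ j, |(wsawQuadFlow L s).flow g₀ j 2| ≤
          C' * chi (betaPT 4 L s) Ω j * (wsawQuadFlow L s).flow g₀ j 0)) ∧
      (∀ j, ContinuousOn (fun p : Icc (0 : ℝ) δ × ℝ => (wsawQuadFlow L (p.1 : ℝ)).flow p.2 j)
        {p | 0 < p.2 ∧ p.2 < g₁}) := by
  obtain ⟨δ, B, c, C, hδ, hδ1, hA⟩ := hypA1_and_hypA2_wsawQuadFlow hL hΩ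
  have hc : 0 < c := (hA 0 le_rfl hδ.le).1.c_pos
  have hlam : (1 : ℝ) < L ^ 2 := by nlinarith
  obtain ⟨g₁, C', Cn, hg₁, hflow⟩ := quadFlow_exists_unique (B := B) (C := C) hΩ hc hlam
  set g₂ : ℝ := min g₁ (quadThreshold Ω B c C (L ^ 2)) with hg₂
  have hg₂pos : 0 < g₂ := lt_min hg₁ (quadThreshold_pos hΩ hc hlam)
  refine ⟨δ, g₂, C', Cn, hδ, hδ1, hg₂pos, fun s hs hsδ g₀ hg₀ hg₀₁ => ?_, fun j => ?_⟩
  · obtain ⟨h1, h2⟩ := hA s hs hsδ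
    exact hflow (wsawQuadFlow L s) h1 h2 g₀ ⟨hg₀, hg₀₁.trans_le (min_le_left _ _)⟩
  · have hA' : ∀ m : Icc (0 : ℝ) δ,
        HypA1 ((fun m : Icc (0 : ℝ) δ => wsawQuadFlow L (m : ℝ)) m).β Ω B c ∧
          HypA2 ((fun m : Icc (0 : ℝ) δ => wsawQuadFlow L (m : ℝ)) m) Ω (L ^ 2) c C :=
      fun m => hA m m.2.1 m.2.2
    have hP : CoeffContinuous (fun m : Icc (0 : ℝ) δ => wsawQuadFlow L (m : ℝ)) :=
      coeffContinuous_wsawQuadFlow (by linarith) fun x hx => hx.1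
    exact (continuousOn_flow_param hΩ hA' hP j).mono fun p hp => ⟨hp.1, hp.2.le.trans (min_le_right _ _)⟩

/-- **Proposition 6.1.1 at the critical point `m² = 0`** (`j_Ω = ∞`, `χ_j = 1`): for `ḡ₀ ∈ (0,g₁)` the
flow `V̄ = (wsawQuadFlow L 0).flow ḡ₀` of `φ̄(0)` satisfies `ḡ_j^p ≤ C_p(ḡ₀/(1+ḡ₀j))^p` (real `p ≥ 1`),
`|z̄_j| ≤ C'ḡ_j`, `|μ̄_j| ≤ C'ḡ_j`, besides being the unique global flow with `ḡ₀` prescribed and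
`(z̄_∞, μ̄_∞) = (0,0)`.
[cite: BauerschmidtBrydgesSlade2015LogCorr, Proposition 6.1.1 and §6.1 ("j_Ω = ∞ if and only if m² = 0")] -/
theorem BBS2015_prop611_critical {L : ℝ} (hL : 2 ≤ L) :
    ∃ g₁ C' : ℝ, ∃ Cn : ℝ → ℝ, 0 < g₁ ∧
      ∀ g₀ : ℝ, 0 < g₀ → g₀ < g₁ →
        IsQuadFlowBC (wsawQuadFlow L 0) g₀ ((wsawQuadFlow L 0).flow g₀) ∧
        (∀ Vb : ℕ → V3, IsQuadFlowBC (wsawQuadFlow L 0) g₀ Vb → Vb = (wsawQuadFlow L 0).flow g₀) ∧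
        (∀ j, 0 < (wsawQuadFlow L 0).flow g₀ j 0 ∧ (wsawQuadFlow L 0).flow g₀ j 0 ≤ C' * g₀) ∧
        (∀ n : ℝ, 1 ≤ n → ∀ j : ℕ,
          (wsawQuadFlow L 0).flow g₀ j 0 ^ n ≤ Cn n * (g₀ / (1 + g₀ * j)) ^ n) ∧
        (∀ j, |(wsawQuadFlow L 0).flow g₀ j 1| ≤ C' * (wsawQuadFlow L 0).flow g₀ j 0) ∧
        (∀ j, |(wsawQuadFlow L 0).flow g₀ j 2| ≤ C' * (wsawQuadFlow L 0).flow g₀ j 0) := by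
  obtain ⟨δ, g₁, C', Cn, hδ, -, hg₁, hmain, -⟩ := BBS2015_prop611 hL one_lt_two
  refine ⟨g₁, C', Cn, hg₁, fun g₀ hg₀ hg₀₁ => ?_⟩
  obtain ⟨h1, h2, h3, h4, h5, h6⟩ := hmain 0 le_rfl hδ.le g₀ hg₀ hg₀₁
  refine ⟨h1, h2, h3, fun n hn j => ?_, fun j => ?_, fun j => ?_⟩
  · simpa [chi_betaPT_zero hL one_lt_two] using h4 n hn j
  · simpa [chi_betaPT_zero hL one_lt_two] using h5 j
  · simpa [chi_betaPT_zero hL one_lt_two] using h6 j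

/-- **Proposition 6.1.1, differentiability in the initial condition, for the weakly self-avoiding
walk** (`d = 4`, `L ≥ 2`, `Ω > 1`): there are `δ ∈ (0,1]`, `g₁ > 0` and `K` such that for every
`m² ∈ [0,δ]`, every `ḡ₀ ∈ (0,g₁)` and every `j`, the three components of
`ḡ₀ ↦ V̄_j = (wsawQuadFlow L m²).flow ḡ₀` are differentiable at `ḡ₀`, with derivatives
`(ḡ_j', z̄_j', μ̄_j')` obeying `|ḡ_j'| ≤ ḡ_j²/ḡ₀²`, `|z̄_j'| ≤ Kχ_jḡ_j²/ḡ₀²`, `|μ̄_j'| ≤ Kχ_jḡ_j²/ḡ₀²`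
([BBS-rg-flow, Lemma 2.3, (2.33)] applied under Assumptions (A1)–(A2) of §6.1), and these
derivatives are continuous in `ḡ₀` — "`V̄_j` is continuously differentiable in the initial condition".
[cite: BauerschmidtBrydgesSlade2015LogCorr, Proposition 6.1.1 ("V̄_j is continuously differentiable in the initial condition ḡ₀"; "a special case of [BBS-rg-flow, Proposition 1.2]")] [cite: BauerschmidtBrydgesSlade2015Flow, Lemma 2.3, (2.33)] -/
theorem BBS2015_prop611_hasDerivAt {L : ℝ} (hL : 2 ≤ L) {Ω : ℝ} (hΩ : 1 < Ω) :
    ∃ δ g₁ K : ℝ, 0 < δ ∧ δ ≤ 1 ∧ 0 < g₁ ∧ 0 < K ∧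
      ∀ s : ℝ, 0 ≤ s → s ≤ δ → ∀ g₀ : ℝ, 0 < g₀ → g₀ < g₁ → ∀ j : ℕ,
        HasDerivAt (fun x => (wsawQuadFlow L s).flow x j 0) (gbarDeriv (betaPT 4 L s) g₀ j) g₀ ∧
        HasDerivAt (fun x => (wsawQuadFlow L s).flow x j 1) ((wsawQuadFlow L s).zbarDeriv g₀ j) g₀ ∧
        HasDerivAt (fun x => (wsawQuadFlow L s).flow x j 2) ((wsawQuadFlow L s).mubarDeriv g₀ j) g₀ ∧
        |gbarDeriv (betaPT 4 L s) g₀ j| ≤ (wsawQuadFlow L s).flow g₀ j 0 ^ 2 / g₀ ^ 2 ∧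
        |(wsawQuadFlow L s).zbarDeriv g₀ j| ≤
          K * chi (betaPT 4 L s) Ω j * (wsawQuadFlow L s).flow g₀ j 0 ^ 2 / g₀ ^ 2 ∧
        |(wsawQuadFlow L s).mubarDeriv g₀ j| ≤
          K * chi (betaPT 4 L s) Ω j * (wsawQuadFlow L s).flow g₀ j 0 ^ 2 / g₀ ^ 2 ∧
        ContinuousAt (fun x => gbarDeriv (betaPT 4 L s) x j) g₀ ∧
        ContinuousAt (fun x => (wsawQuadFlow L s).zbarDeriv x j) g₀ ∧
        ContinuousAt (fun x => (wsawQuadFlow L s).mubarDeriv x j) g₀ := by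
  obtain ⟨δ, B, c, C, hδ, hδ1, hA⟩ := hypA1_and_hypA2_wsawQuadFlow hL hΩ
  have hc : 0 < c := (hA 0 le_rfl hδ.le).1.c_pos
  have hB : 0 ≤ B := (hA 0 le_rfl hδ.le).1.B_nonneg
  have hlam : (1 : ℝ) < L ^ 2 := by nlinarith
  have hC : 0 ≤ C := by
    have h2 := (hA 0 le_rfl hδ.le).2
    have h1 := h2.eta_le 0
    have hχ := (chi_pos_and_le_one (wsawQuadFlow L 0).β hΩ.le 0).1
    by_contra hC'
    have : C * chi (wsawQuadFlow L 0).β Ω 0 < 0 := mul_neg_of_neg_of_pos (lt_of_not_ge hC') hχ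
    linarith [abs_nonneg ((wsawQuadFlow L 0).η 0)]
  set N : ℕ := ⌊c⁻¹⌋₊ with hN
  set C20 : ℝ := (1 + N) / c + N + 2 * Ω / (Ω - 1) with hC20
  have hC20pos : 0 ≤ C20 := by
    rw [hC20]
    have : 0 ≤ 2 * Ω / (Ω - 1) := div_nonneg (by linarith) (by linarith)
    positivity
  set α : ℝ := 2 / (1 + L ^ 2) with hα
  have hα0 : 0 ≤ α := by positivity
  have hα1 : α < 1 := by rw [hα, div_lt_one (by positivity)]; nlinarith
  -- thresholds: the quadratic-flow threshold and the smallness `8B²C_{2,0}b ≤ 1` of Lemma 2.3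
  set g₁ : ℝ := min (quadThreshold Ω B c C (L ^ 2)) (1 / (8 * B ^ 2 * C20 + 1)) with hg₁
  have hg₁pos : 0 < g₁ := lt_min (quadThreshold_pos hΩ hc hlam) (by positivity)
  have hsmall : 8 * B ^ 2 * C20 * g₁ ≤ 1 := by
    have h1 : g₁ ≤ 1 / (8 * B ^ 2 * C20 + 1) := min_le_right _ _
    have h2 : 0 ≤ 8 * B ^ 2 * C20 := by positivity
    calc 8 * B ^ 2 * C20 * g₁ ≤ 8 * B ^ 2 * C20 * (1 / (8 * B ^ 2 * C20 + 1)) :=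
          mul_le_mul_of_nonneg_left h1 h2
      _ ≤ 1 := by rw [mul_one_div, div_le_one (by positivity)]; linarith
  set K : ℝ := max (zDerivConst C C20) (mubarDerivConst C C20 α * (α / (1 - α))) + 1 with hK
  have hKz : zDerivConst C C20 ≤ K := by rw [hK]; linarith [le_max_left (zDerivConst C C20) (mubarDerivConst C C20 α * (α / (1 - α)))]
  have hKμ : mubarDerivConst C C20 α * (α / (1 - α)) ≤ K := by
    rw [hK]; linarith [le_max_right (zDerivConst C C20) (mubarDerivConst C C20 α * (α / (1 - α)))]
  have hK0 : 0 < K := by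
    rw [hK]
    have := zDerivConst_nonneg hC hC20pos
    linarith [le_max_left (zDerivConst C C20) (mubarDerivConst C C20 α * (α / (1 - α)))]
  refine ⟨δ, g₁, K, hδ, hδ1, hg₁pos, hK0, fun s hs hsδ g₀ hg₀ hg₀₁ j => ?_⟩
  obtain ⟨hA1, hA2⟩ := hA s hs hsδ
  -- the hypotheses of Lemma 2.2/2.3 at the top initial condition `b = g₁`
  obtain ⟨hb, -, -⟩ := cutoffQuadHyp_of_hypA hΩ hA1 hA2 hg₁pos (min_le_left _ _)
  obtain ⟨d0, d1, d2, b0, b1, b2⟩ := hasDerivAt_flow hb hsmall hg₀ hg₀₁ j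
  obtain ⟨c0, c1, c2⟩ := continuousAt_flowDeriv hb hsmall hg₀ hg₀₁ j
  have hw : 0 ≤ cutoffWeight Ω (jOmega (wsawQuadFlow L s).β Ω) j :=
    (chi_pos_and_le_one (wsawQuadFlow L s).β hΩ.le j).1.le
  refine ⟨d0, d1, d2, ?_, ?_, ?_, by simpa only [wsawQuadFlow_β] using c0, c1, c2⟩
  · simpa only [QuadFlowParams.flow_apply_zero, wsawQuadFlow_β] using b0
  · calc |(wsawQuadFlow L s).zbarDeriv g₀ j|
        ≤ zDerivConst C C20 * (cutoffWeight Ω (jOmega (wsawQuadFlow L s).β Ω) j *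
            gbar (wsawQuadFlow L s).β g₀ j ^ 2) / g₀ ^ 2 := b1
      _ ≤ K * (cutoffWeight Ω (jOmega (wsawQuadFlow L s).β Ω) j *
            gbar (wsawQuadFlow L s).β g₀ j ^ 2) / g₀ ^ 2 :=
          div_le_div_of_nonneg_right (mul_le_mul_of_nonneg_right hKz (mul_nonneg hw (sq_nonneg _)))
            (sq_nonneg _)
      _ = K * chi (betaPT 4 L s) Ω j * (wsawQuadFlow L s).flow g₀ j 0 ^ 2 / g₀ ^ 2 := by
          simp only [QuadFlowParams.flow_apply_zero, wsawQuadFlow_β, chi]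
          ring
  · calc |(wsawQuadFlow L s).mubarDeriv g₀ j|
        ≤ mubarDerivConst C C20 α * (α / (1 - α)) * (cutoffWeight Ω (jOmega (wsawQuadFlow L s).β Ω) j *
            gbar (wsawQuadFlow L s).β g₀ j ^ 2) / g₀ ^ 2 := b2
      _ ≤ K * (cutoffWeight Ω (jOmega (wsawQuadFlow L s).β Ω) j *
            gbar (wsawQuadFlow L s).β g₀ j ^ 2) / g₀ ^ 2 :=
          div_le_div_of_nonneg_right (mul_le_mul_of_nonneg_right hKμ (mul_nonneg hw (sq_nonneg _)))
            (sq_nonneg _)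
      _ = K * chi (betaPT 4 L s) Ω j * (wsawQuadFlow L s).flow g₀ j 0 ^ 2 / g₀ ^ 2 := by
          simp only [QuadFlowParams.flow_apply_zero, wsawQuadFlow_β, chi]
          ring

end CTWSAW

end Literature.Barriers.CriticalPhenomena
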